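import Summits.ValiantsHypothesis.ValiantsHypothesis.Theses.DivisionGap
import Summits.ValiantsHypothesis.ValiantsHypothesis.Theorems.DivisionGapZeroOneTransferStubZotOfUniform
import Summits.ValiantsHypothesis.ValiantsHypothesis.Theorems.DivisionGapZeroOneTransferStubUniformOfZot

/-!
# Crux `DivisionGap.ZeroOneTransfer` (stmt-ValiantsHypothesis-5066) — UNIFORMITY of H2
(line `charged-uncharged`, Part C of lead c11: composition of the landed stubs
`stub_uniformOfZot` p148580 and `stub_zotOfUniform` p147049)

`zeroOneTransfer_iff_uniform : ZeroOneTransfer ↔ ZOT_uniform`, where the UNIFORM FORM asks, for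
every exponent `e`, for ONE constant `c` such that every 0/1-coefficient polynomial `f` over `ℝ≥0`
in a finite variable type of size `≤ n^e + e`, of total degree `≤ n^e + e` and of `ℂ`-complexity
`≤ n^e + e`, has a nonzero `h` with `L₊(f · h) + L₊(h) ≤ 2^((log₂ n + c)^c)`.

So the `∃ c` placed AFTER the family in the crux gives no protection (STRATEGY-CENSUS §2e of the
crux chain, recorded there as a signature only): `⇐` is bookkeeping (one exponent dominates the
three p-bounds of `IsVPFamily`); `⇒` is finiteness + diagonal (at a fixed level only finitely many
0/1 polynomials of bounded degree live in `Fin (n^e+e)`, so a violating level must grow with `c`;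
the worst violator of each level assembles into ONE 0/1 `VP_ℂ` family whose crux constant is then
contradicted; arbitrary variable types reduce to `Fin (n^e+e)` because division certificates pull
back along injective renamings at no cost, `stub_divSubstClosure`).

Consequences.  For refuters: a counterexample to H2 may be assembled from FINITE witnesses
`(n, f)` with uniformly p-bounded data — no single infinite family has to be exhibited.  For
provers: the exponent `e` may be fixed before `c` is chosen.  No `def` is declared. [folklore]
-/

open Summit.ValiantsHypothesis.ValiantsHypothesis.Theses.DivisionGap

-- `Summit.ValiantsHypothesis.ValiantsHypothesis.…`: mandated single-conjunct layout (Sub = Summit).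
set_option linter.dupNamespace false

namespace Summit.ValiantsHypothesis.ValiantsHypothesis.Theorems.DivisionGapZeroOneTransfer

/-- **UNIFORMITY of the crux `ZeroOneTransfer`** (H2 of route DivisionGap): the crux is
equivalent to its uniform form — for every exponent `e` one constant `c` serving every level `n`,
every finite variable type of size `≤ n^e + e` and every 0/1-coefficient polynomial over `ℝ≥0` of
total degree and `ℂ`-complexity `≤ n^e + e`.  Composition of the registered stubs
`stub_uniformOfZot` (finiteness + diagonal) and `stub_zotOfUniform` (bookkeeping). [folklore] -/
theorem zeroOneTransfer_iff_uniform :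
    ZeroOneTransfer ↔
    ∀ e : ℕ, ∃ c : ℕ, ∀ (n : ℕ) (τ : Type) [Fintype τ] (f : MvPolynomial τ NNReal),
      (∀ m, MvPolynomial.coeff m f = 0 ∨ MvPolynomial.coeff m f = 1) →
      Fintype.card τ ≤ n ^ e + e → f.totalDegree ≤ n ^ e + e →
      Literature.Computability.AlgebraicComplexity.complexity
        (MvPolynomial.map (Complex.ofRealHom.comp NNReal.toRealHom) f) ≤ n ^ e + e →
      ∃ h : MvPolynomial τ NNReal, h ≠ 0 ∧
        Literature.Computability.AlgebraicComplexity.complexity (f * h) +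
          Literature.Computability.AlgebraicComplexity.complexity h ≤ 2 ^ ((Nat.log 2 n + c) ^ c) :=
  ⟨stub_uniformOfZot, stub_zotOfUniform⟩

/-- **Refuter's form of uniformity**: H2 fails as soon as, for ONE exponent `e`, every constant `c`
is beaten by some FINITE witness — a level `n` and a 0/1 polynomial with `≤ n^e + e` variables,
degree and `ℂ`-complexity, all of whose division certificates cost more than
`2^((log₂ n + c)^c)` (contrapositive of `stub_uniformOfZot`). [folklore] -/
theorem not_zeroOneTransfer_of_finite_witnesses (e : ℕ)
    (hw : ∀ c : ℕ, ∃ (n : ℕ) (τ : Type) (_ : Fintype τ) (f : MvPolynomial τ NNReal),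
      (∀ m, MvPolynomial.coeff m f = 0 ∨ MvPolynomial.coeff m f = 1) ∧
      Fintype.card τ ≤ n ^ e + e ∧ f.totalDegree ≤ n ^ e + e ∧
      Literature.Computability.AlgebraicComplexity.complexity
        (MvPolynomial.map (Complex.ofRealHom.comp NNReal.toRealHom) f) ≤ n ^ e + e ∧
      ∀ h : MvPolynomial τ NNReal, h ≠ 0 →
        2 ^ ((Nat.log 2 n + c) ^ c) <
          Literature.Computability.AlgebraicComplexity.complexity (f * h) +
            Literature.Computability.AlgebraicComplexity.complexity h) :
    ¬ ZeroOneTransfer := by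
  intro hZ
  obtain ⟨c, hc⟩ := stub_uniformOfZot hZ e
  obtain ⟨n, τ, _, f, h01, hcard, hdeg, hcx, hbad⟩ := hw c
  obtain ⟨h, hh, hle⟩ := hc n τ f h01 hcard hdeg hcx
  exact absurd hle (not_le.2 (hbad h hh))

end Summit.ValiantsHypothesis.ValiantsHypothesis.Theorems.DivisionGapZeroOneTransfer
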